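import Mathlib
import Literature.AlgebraicGeometry.HodgeTheory.WeilClassesCyclicPrym
import Literature.AlgebraicGeometry.VanGeemenVerra2003.QuaternionicHodgeClasses
import HarnessLib

/-!
# WeilClassesCyclicPrymDegreeFour

Topic `Literature/AlgebraicGeometry/HodgeTheory`. Named literature fact(s) relocated by the gate from `Summits/HodgeConjecture/HodgeConjecture/Theorems/WeilTypeLadderQuaternionicPrym.lean`
(accept-time relocation of `[cite]`d propositions written inline in a Summits proposal; human ruling 2026-08-15).
Sources: PatelZhang2025PrymHodge, Schoen1988HodgeWeil, vanGeemenVerra2003QuaternionicPryms.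

* `Literature.AlgebraicGeometry.HodgeTheory.Schoen1988_cyclicPrym_weilClasses_algebraic_degreeFour`
-/

namespace Literature.AlgebraicGeometry.HodgeTheory

open CategoryTheory
open Literature.AlgebraicGeometry Literature.AlgebraicGeometry.Motives
open Literature.AlgebraicGeometry.HodgeTheory
open Literature.AlgebraicTopology.SingularHomology
open Literature.AlgebraicGeometry.VanGeemenVerra2003

/-- **Schoen's cyclic theorem, degree `4` over genus `5`: the primitive Prym EIGHTFOLD of `ℚ(i)`-Weil type** (Schoen
1988, Thm. 2.0 + Cor. 3.1 at `(q, m, r) = (5, 4, 0)` = Patel–Zhang 2025, Thm. 1.2 / Thm. 5.3 with §5.1 at `G = ℤ/4`,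
`g(C') = 5`), on the tree's carriers — the literal `m = 4` sibling of
`Schoen1988_cyclicPrym_weilClasses_algebraic_degreeThree` (`m = 3`) and `…_degreeSix` (`m = 6`), same sources, same
rendering and typing. PRINTED STATEMENT: Schoen 1988, Cor. 3.1 (p. 24): "If `(C, σ)` satisfies the hypotheses of
(2.0), then `U' ⊂ H^h(B, ℚ)` is generated by fundamental classes of codimension `h/2` algebraic cycles" — `B ⊂ J(C)`
the abelian subvariety on which `σ` acts through the PRIMITIVE `m`-th roots of unity, `U' = ⋀^h_{ℚ(μ_m)} H¹(B, ℚ)`,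
`h = 2q - 2` for an unramified (`r = 0`) cyclic cover `C → C/⟨σ⟩` of degree `m` of a genus-`q` curve, the hypotheses of
Thm. 2.0 (p. 11) being "automatically satisfied if `r = 0`"; Patel–Zhang 2025 (arXiv:2506.13729), Thm. 5.3:
"(Schoen88). `U_prim` is generated by algebraic cycles", `U_prim := ⋀^h_{ℚ(μ_m)} H¹(B_prim, ℚ)`, `B_prim = J(C)_{V_prim}`
(§5.1: "`H¹(B_prim, ℚ)` is a vector space over `ℚ(μ_m)`, and … `T₀B_prim` decomposes as a direct sum of eigenspaces
corresponding to the primitive characters, with each character appearing with multiplicity `h/2`"), and p. 4: "When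
`m = 3` (resp. `4`), these give rise to Weil abelian [varieties] with CM field `ℚ(μ₃)` (resp. `ℚ(i)`) with trivial
discriminant". No genericity hypothesis on the cover. This is the instance van Geemen–Verra 2003 invoke (Cor. 4.10:
"consider the 4:1 unramified cover `π_i : C̃ → C̃/⟨i⟩`. By Schoen's result [S1], applied to the cover `π_i`, the
space of Weil classes `W_K ⊂ H^{4(g-1)}(P, ℚ)` is spanned by cycle classes", `g = 3`).
RENDERING (dictionary steps marked; binder shape of the siblings): `C` is a smooth projective complex curve with a
Jacobian `𝒥` (`Motives.Jacobian`) of dimension `17` (= `g(C)`) and an automorphism `α` with `α⁴ = 𝟙` whose square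
`α²` has no fixed complex point — so `⟨α⟩ ≅ ℤ/4` acts freely (a fixed point of `α` or `α³` is one of `α²`),
`C → C' := C/⟨α⟩` is étale cyclic of degree `4`, and by Riemann–Hurwitz `32 = 2·17 - 2 = 4·(2g(C') - 2)`, i.e.
`g(C') = 5`, `h = 8`; `s := α_*` (`Jacobian.pushforward`), `e := s²` (a separate binder `e` with `e = s ≫ s`, so that
commuting order-`4` automorphisms with the same square address the same `B`) and
`B := (ker (𝟙 + e))⁰ = (ker Φ₄(s))⁰` (`AbelianVariety.kerComponent`; `Φ₄(x) = x² + 1` vanishes at `± i` and at no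
other fourth root of unity: `Φ₄(±1) = 2`), which IS `B_prim` (`H¹(B; ℂ) = H¹_{i} ⊕ H¹_{-i}`, `8 + 8`, an abelian
EIGHTFOLD); `s_B` is the restriction of `s` to `B` (it exists: `kerComponentRestrict`) and the Weil operator is
`ψ₀ := s_B` itself (`s_B² = -𝟙` on `B`, `kerComponent_restrict_comp_self_eq_neg_id` below: `ℚ(ψ₀) = ℚ(μ₄) = ℚ(i)`).
TYPING (bookkeeping NOT in print, as the siblings): on `H⁸(B(ℂ); ℂ) = ⋀⁸ H¹` the tree's Weil plane
`weilClassesOf B ψ₀ 4 1 = E₊ ⊔ E₋` (`WeilClasses.lean`) is EXACTLY `⋀⁸ H¹_{i} ⊕ ⋀⁸ H¹_{-i} = U_prim ⊗ ℂ`, and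
"`U_prim` is generated by algebraic cycles" is "every class of `weilClassesOf B ψ₀ 4 1` lies in
`algebraicClasses B.X 4`".
-- TODO(general form): Schoen Cor. 3.1 / PZ Thm 1.2 for all `m`, `q` (and all abelian `G`), once the tree has the
-- `χ`-isotypic decomposition of `H¹` of a `G`-abelian variety and `⋀^h_{ℚ[G]_nt}` on real carriers.
[cite: Schoen1988HodgeWeil, Thm 2.0 (p. 11) and Cor 3.1 (p. 24), at (q, m, r) = (5, 4, 0)]
[cite: PatelZhang2025PrymHodge, Thm 1.2, §5.1 and Thm 5.3]
[cite: vanGeemenVerra2003QuaternionicPryms, Cor. 4.10 (the instance invoked)]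
[file AlgebraicGeometry/HodgeTheory/WeilClassesCyclicPrymDegreeFour] -/
def Schoen1988_cyclicPrym_weilClasses_algebraic_degreeFour : Prop :=
  ∀ (C : SchemeOver ℂ) (𝒥 : Jacobian C) (α : C ⟶ C),
    IsSmoothProjective 1 C → 𝒥.J.dim = 17 →
    α ≫ α ≫ α ≫ α = 𝟙 C →
    (∀ P : ComplexPoints C, P ≫ (α ≫ α) ≠ P) →
  ∀ (s e : 𝒥.J ⟶ 𝒥.J), s = 𝒥.pushforward 𝒥 α → e = s ≫ s →
  ∀ (sB : AbelianVariety.kerComponent (𝟙 𝒥.J + e) ⟶ AbelianVariety.kerComponent (𝟙 𝒥.J + e)),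
    sB ≫ AbelianVariety.kerComponentι (𝟙 𝒥.J + e) = AbelianVariety.kerComponentι (𝟙 𝒥.J + e) ≫ s →
  ∀ c ∈ weilClassesOf (AbelianVariety.kerComponent (𝟙 𝒥.J + e)) sB 4 1,
    c ∈ algebraicClasses (AbelianVariety.kerComponent (𝟙 𝒥.J + e)).X 4

/-! ### §3 The theorems on the quaternionic Prym `P` -/

end Literature.AlgebraicGeometry.HodgeTheory
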